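import Mathlib.LinearAlgebra.Matrix.ToLinearEquiv
import Mathlib.LinearAlgebra.Dimension.Finite
import Mathlib.LinearAlgebra.FiniteDimensional.Lemmas
import Mathlib.RingTheory.PowerSeries.Trunc
import Mathlib.Algebra.BigOperators.Field
import Mathlib.Tactic.FieldSimp
import Mathlib.Tactic.LinearCombination
import Mathlib.Tactic.Push
import HarnessLib

/-!
# Kronecker's rationality criterion (Hankel determinants) — proof

Part of the bottom-up proof of Dwork's rationality theorem
(`Literature/NumberTheory/LFunctions/DworkRationality.lean`, fact `isRationalZeta_torusCount`,
via the Borel–Dwork criterion). This file proves the "if" direction of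

> **Koblitz, Ch. V §5, Lemma 5** (Kronecker). Let `F(T) = ∑ a_i Tⁱ ∈ K⟦T⟧`, `K` a field, and
> `N_{s,m} = det (a_{s+i+j})_{0 ≤ i,j ≤ m}`. Then `F` is a quotient of two polynomials iff there
> exist `m ≥ 0` and `S` such that `N_{s,m} = 0` whenever `s ≥ S`,

as `Literature.NumberTheory.LFunctions.Dwork.exists_polynomial_of_hankelDet_eq_zero`: if `N_{s,m} = 0` for all `s ≥ S` then
`F · Q = P` for some `P, Q ∈ K[T]`, `Q ≠ 0`.

## Proof

We follow Koblitz (pp. 135–136) but organise the induction on `m` so that no minimality of `m`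
is needed. Write `D(s, m)` (`Literature.Dwork.HankelRel a s m`) for "the rows of `A_{s,m}` are linearly
dependent", i.e. `N_{s,m} = 0` (`hankelRel_iff_det_eq_zero`, Mathlib
`Matrix.exists_vecMul_eq_zero_iff`).
* *Propagation* (`hankelRel_succ`, Koblitz's two cases): `D(s, m+1) ∧ D(s, m) → D(s+1, m)`.
  If `∑_{i ≤ m} λ_i a_{s+i+j} = 0` (`j ≤ m`) and `β = ∑ λ_i a_{s+i+m+1}`: for `β = 0` the same
  `λ` works at `s + 1`; for `β ≠ 0, λ₀ = 0` the shifted `λ` works; for `λ₀ ≠ 0` one combines with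
  the relation `μ` of order `m + 1` (`ρ_i = μ_{i+1} - μ₀ λ_{i+1}/λ₀`), which is non-trivial since
  otherwise the last equation of `μ` reads `μ₀ β / λ₀ = 0`.
* *Induction on `m`* (`exists_polynomial_of_hankelRel`): `m = 0` means `a_s = 0` for `s ≥ S`.
  For `m + 1`: either some `D(s₀, m)`, `s₀ ≥ S`, holds — then `D(s, m)` for all `s ≥ s₀` by
  propagation and we conclude by induction — or no `D(s, m)` holds, so every relation of order
  `m + 1` has non-zero top coefficient (`exists_top_relation`): each row `v_{s+m+1}` is a
  combination of `v_s, …, v_{s+m}` (vectors `v_t = (a_t, …, a_{t+m+1}) ∈ K^{m+2}`). A non-zero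
  `u ∈ K^{m+2}` orthogonal to `v_S, …, v_{S+m}` exists (`m + 2` unknowns, `m + 1` equations:
  `LinearIndependent.fintype_card_le_finrank`), hence `u ⊥ v_t` for all `t ≥ S` by induction, and
  `Q = ∑ u_j T^{m+1-j}` kills all coefficients of `F · Q` of degree `≥ S + m + 1`.

## References

* N. Koblitz, *p-adic Numbers, p-adic Analysis, and Zeta-Functions*, 2nd ed., GTM 58 (1984),
  Ch. V §5, Lemma 5, pp. 134–136. [Koblitz1984]
-/

open Finset

noncomputable section

namespace Literature.NumberTheory.LFunctions
namespace Dwork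

variable {K : Type*} [Field K]

/-- The Hankel matrix `A_{s,m} = (a_{s+i+j})_{0 ≤ i, j ≤ m}` of a sequence `a` (Koblitz, Ch. V §5,
Lemma 5); its determinant is Koblitz's `N_{s,m}`. [cite: Koblitz1984, Ch. V §5 Lemma 5] -/
def hankelMatrix (a : ℕ → K) (s m : ℕ) : Matrix (Fin (m + 1)) (Fin (m + 1)) K :=
  Matrix.of fun i j => a (s + i + j)

/-- `D(s, m)`: the rows of `A_{s,m}` are linearly dependent, written with coefficients indexed by
`ℕ` and supported in `[0, m]`: a non-trivial relation `∑_{i ≤ m} c_i a_{s+i+j} = 0` for all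
`j ≤ m` (equivalent to `N_{s,m} = 0`, `hankelRel_iff_det_eq_zero`). [cite: Koblitz1984, Ch. V §5 Lemma 5] -/
def HankelRel (a : ℕ → K) (s m : ℕ) : Prop :=
  ∃ c : ℕ → K, (∃ i ≤ m, c i ≠ 0) ∧ (∀ i, m < i → c i = 0) ∧
    ∀ j ≤ m, ∑ i ∈ range (m + 1), c i * a (s + i + j) = 0

/-- `D(s, m) ↔ N_{s,m} = 0` (a square matrix over a field is singular iff its rows are
dependent, Mathlib `Matrix.exists_vecMul_eq_zero_iff`). [folklore] -/
theorem hankelRel_iff_det_eq_zero (a : ℕ → K) (s m : ℕ) :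
    HankelRel a s m ↔ (hankelMatrix a s m).det = 0 := by
  rw [← Matrix.exists_vecMul_eq_zero_iff]
  constructor
  · rintro ⟨c, ⟨i, hi, hci⟩, -, h⟩
    refine ⟨fun i => c i, fun h0 => hci (by simpa using congr_fun h0 ⟨i, by omega⟩), funext fun j => ?_⟩
    rw [Matrix.vecMul, dotProduct, Pi.zero_apply, ← h j (by omega), Finset.sum_range]
    rfl
  · rintro ⟨c, hc, h⟩
    refine ⟨fun i => if hi : i < m + 1 then c ⟨i, hi⟩ else 0, ?_, fun i hi => dif_neg (by omega),
      fun j hj => ?_⟩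
    · by_contra hne
      push Not at hne
      apply hc
      funext i
      have := hne i (by omega)
      simpa [i.2] using this
    · have := congr_fun h ⟨j, by omega⟩
      rw [Matrix.vecMul, dotProduct] at this
      rw [Finset.sum_range]
      have hc' : ∀ x : Fin (m + 1), (if hi : (x : ℕ) < m + 1 then c ⟨x, hi⟩ else 0) = c x :=
        fun x => by rw [dif_pos x.2]
      simp only [hc']
      simpa [hankelMatrix, Matrix.of_apply] using this

/-- Sums against a function supported in `[0, m]` may be extended by one term. [folklore] -/
theorem sum_range_succ_of_supp {c : ℕ → K} {m : ℕ} (hc : ∀ i, m < i → c i = 0) (f : ℕ → K) :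
    ∑ i ∈ range (m + 2), c i * f i = ∑ i ∈ range (m + 1), c i * f i := by
  rw [Finset.sum_range_succ, hc (m + 1) (Nat.lt_succ_self m), zero_mul, add_zero]

/-- **Propagation** (Koblitz, Ch. V §5, proof of Lemma 5, the two cases `i₀ > 0` / `i₀ = 0`):
`N_{s,m+1} = 0` and `N_{s,m} = 0` imply `N_{s+1,m} = 0`. [cite: Koblitz1984, Ch. V §5 Lemma 5] -/
theorem hankelRel_succ (a : ℕ → K) {s m : ℕ} (h1 : HankelRel a s (m + 1)) (h0 : HankelRel a s m) :
    HankelRel a (s + 1) m := by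
  obtain ⟨lam, ⟨i₀, hi₀, hli₀⟩, hsupp, hl⟩ := h0
  -- shifted sums against `lam`
  have hshift : ∀ j, ∑ i ∈ range (m + 1), lam (i + 1) * a (s + (i + 1) + j) =
      ∑ i ∈ range (m + 1), lam i * a (s + i + j) - lam 0 * a (s + 0 + j) := by
    intro j
    rw [eq_sub_iff_add_eq, ← Finset.sum_range_succ' (fun i => lam i * a (s + i + j)),
      sum_range_succ_of_supp hsupp]
  set β := ∑ i ∈ range (m + 1), lam i * a (s + i + (m + 1)) with hβ
  by_cases hb : β = 0
  · -- Case β = 0: the same relation, shifted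
    refine ⟨lam, ⟨i₀, hi₀, hli₀⟩, hsupp, fun j hj => ?_⟩
    simp_rw [show ∀ i, s + 1 + i + j = s + i + (j + 1) from fun i => by ring]
    rcases Nat.lt_or_ge (j + 1) (m + 1) with hj' | hj'
    · exact hl (j + 1) (by omega)
    · rw [show j + 1 = m + 1 by omega]; exact hb
  by_cases hl0 : lam 0 = 0
  · -- Case λ₀ = 0: drop the first coefficient
    refine ⟨fun i => lam (i + 1), ⟨i₀ - 1, by omega, ?_⟩, fun i hi => hsupp _ (by omega),
      fun j hj => ?_⟩
    · have : i₀ ≠ 0 := fun h => hli₀ (h ▸ hl0)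
      show lam (i₀ - 1 + 1) ≠ 0
      rwa [Nat.sub_add_cancel (Nat.pos_of_ne_zero this)]
    · simp_rw [show ∀ i, s + 1 + i + j = s + (i + 1) + j from fun i => by ring]
      rw [hshift, hl j hj, hl0, zero_mul, sub_zero]
  · -- Case λ₀ ≠ 0: combine with the relation of order `m + 1`
    obtain ⟨mu, ⟨i₁, hi₁, hmi₁⟩, hmsupp, hm⟩ := h1
    have hmshift : ∀ j, ∑ i ∈ range (m + 1), mu (i + 1) * a (s + (i + 1) + j) =
        ∑ i ∈ range (m + 1 + 1), mu i * a (s + i + j) - mu 0 * a (s + 0 + j) := by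
      intro j
      rw [eq_sub_iff_add_eq, ← Finset.sum_range_succ' (fun i => mu i * a (s + i + j))]
    refine ⟨fun i => mu (i + 1) - mu 0 * lam (i + 1) / lam 0, ?_,
      fun i hi => by
        show mu (i + 1) - mu 0 * lam (i + 1) / lam 0 = 0
        rw [hmsupp (i + 1) (by omega), hsupp (i + 1) (by omega)]; ring, fun j hj => ?_⟩
    · -- non-triviality
      by_contra hρ
      push Not at hρ
      have hρ' : ∀ i, mu (i + 1) = mu 0 * lam (i + 1) / lam 0 := by
        intro i
        rcases Nat.lt_or_ge m i with hi | hi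
        · rw [hmsupp (i + 1) (by omega), hsupp (i + 1) (by omega)]; ring
        · exact sub_eq_zero.mp (hρ i hi)
      -- the last equation of the `μ`-relation gives `μ₀ β = 0`
      have hlast := hm (m + 1) le_rfl
      rw [Finset.sum_range_succ'] at hlast
      simp_rw [hρ'] at hlast
      have e : ∑ i ∈ range (m + 1), mu 0 * lam (i + 1) / lam 0 * a (s + (i + 1) + (m + 1)) =
          mu 0 / lam 0 * (β - lam 0 * a (s + 0 + (m + 1))) := by
        rw [← hshift, Finset.mul_sum]
        exact Finset.sum_congr rfl fun i _ => by ring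
      rw [e] at hlast
      have hmu0 : mu 0 = 0 := by
        field_simp at hlast
        have : mu 0 * β = 0 := by linear_combination hlast
        exact (mul_eq_zero.mp this).resolve_right hb
      apply hmi₁
      rcases i₁ with - | i
      · exact hmu0
      · rw [hρ', hmu0]; ring
    · -- the relation
      simp_rw [show ∀ i, s + 1 + i + j = s + (i + 1) + j from fun i => by ring, sub_mul,
        Finset.sum_sub_distrib]
      have e : ∑ i ∈ range (m + 1), mu 0 * lam (i + 1) / lam 0 * a (s + (i + 1) + j) =
          mu 0 / lam 0 * ∑ i ∈ range (m + 1), lam (i + 1) * a (s + (i + 1) + j) := by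
        rw [Finset.mul_sum]; exact Finset.sum_congr rfl fun i _ => by ring
      rw [e, hshift, hmshift, hl j hj, hm j (by omega)]
      field_simp
      ring

/-- Iterating the propagation: "by induction, we may obtain `N_{s',m-1} = 0` for all `s' ≥ s`"
(Koblitz, Ch. V §5, proof of Lemma 5). [cite: Koblitz1984, Ch. V §5 Lemma 5] -/
theorem hankelRel_of_le (a : ℕ → K) {S m s₀ : ℕ} (h1 : ∀ s, S ≤ s → HankelRel a s (m + 1))
    (hs₀ : S ≤ s₀) (h0 : HankelRel a s₀ m) : ∀ s, s₀ ≤ s → HankelRel a s m := by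
  intro s hs
  induction s, hs using Nat.le_induction with
  | base => exact h0
  | succ s hs ih => exact hankelRel_succ a (h1 s (by omega)) ih

open PowerSeries in
/-- A power series whose coefficients vanish from degree `S` on is a polynomial (its truncation). [folklore] -/
theorem exists_polynomial_of_coeff_eq_zero (f : PowerSeries K) (S : ℕ)
    (h : ∀ n, S ≤ n → coeff n f = 0) : ∃ P : Polynomial K, f = P :=
  ⟨trunc S f, by
    ext n
    rw [Polynomial.coeff_coe, coeff_trunc]
    split_ifs with hn
    · rfl
    · exact h n (not_lt.mp hn)⟩

/-- If `N_{s,m} ≠ 0` then a relation of order `m + 1` has non-zero top coefficient, so the last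
row of `A_{s,m+1}` is a combination of the preceding rows: `a_{s+m+1+j} = ∑_{i ≤ m} d_i a_{s+i+j}`
for `j ≤ m + 1` (Koblitz, Ch. V §5, proof of Lemma 5: "the last row of `A_{s,m}` … is a linear
combination of the preceding `m` rows"). [cite: Koblitz1984, Ch. V §5 Lemma 5] -/
theorem exists_top_relation (a : ℕ → K) {s m : ℕ} (h1 : HankelRel a s (m + 1))
    (h0 : ¬ HankelRel a s m) :
    ∃ d : ℕ → K, ∀ j ≤ m + 1, a (s + (m + 1) + j) = ∑ i ∈ range (m + 1), d i * a (s + i + j) := by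
  obtain ⟨mu, ⟨i₁, hi₁, hmi₁⟩, hsupp, hm⟩ := h1
  have htop : mu (m + 1) ≠ 0 := by
    intro h0'
    apply h0
    refine ⟨mu, ⟨i₁, ?_, hmi₁⟩, fun i hi => ?_, fun j hj => ?_⟩
    · by_contra h'; exact hmi₁ (by rw [show i₁ = m + 1 by omega]; exact h0')
    · rcases Nat.lt_or_ge (m + 1) i with h' | h'
      · exact hsupp i h'
      · rw [show i = m + 1 by omega]; exact h0'
    · have := hm j (by omega)
      rwa [Finset.sum_range_succ, h0', zero_mul, add_zero] at this
  refine ⟨fun i => -(mu i / mu (m + 1)), fun j hj => ?_⟩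
  have := hm j hj
  rw [Finset.sum_range_succ] at this
  simp_rw [neg_mul, Finset.sum_neg_distrib, div_mul_eq_mul_div, ← Finset.sum_div]
  field_simp
  linear_combination this

/-- **Kronecker's rationality criterion**, relation form (Koblitz, Ch. V §5, Lemma 5, "if"
direction): if `D(s, m)` holds for all `s ≥ S`, then `(∑ aᵢ Tⁱ) · Q = P` for polynomials `P`,
`Q ≠ 0`. Induction on `m`, see the module docstring. [cite: Koblitz1984, Ch. V §5 Lemma 5] -/
theorem exists_polynomial_of_hankelRel (a : ℕ → K) :
    ∀ m S : ℕ, (∀ s, S ≤ s → HankelRel a s m) →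
      ∃ P Q : Polynomial K, Q ≠ 0 ∧ PowerSeries.mk a * Q = P := by
  intro m
  induction m with
  | zero =>
    intro S h
    have ha : ∀ n, S ≤ n → PowerSeries.coeff n (PowerSeries.mk a) = 0 := by
      intro n hn
      obtain ⟨c, ⟨i, hi, hci⟩, -, hc⟩ := h n hn
      have hi0 : i = 0 := by omega
      subst hi0
      have := hc 0 le_rfl
      rw [Finset.sum_range_one] at this
      rw [PowerSeries.coeff_mk]
      simpa [hci] using this
    obtain ⟨P, hP⟩ := exists_polynomial_of_coeff_eq_zero _ S ha
    exact ⟨P, 1, one_ne_zero, by rw [Polynomial.coe_one, mul_one, hP]⟩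
  | succ m ih =>
    intro S h
    by_cases hex : ∃ s₀, S ≤ s₀ ∧ HankelRel a s₀ m
    · obtain ⟨s₀, hs₀, h0⟩ := hex
      exact ih s₀ (hankelRel_of_le a h hs₀ h0)
    push Not at hex
    -- top relations for every `s ≥ S`
    choose d hd using fun s (hs : S ≤ s) => exists_top_relation a (h s hs) (hex s hs)
    -- a non-trivial `u ⊥ v_S, …, v_{S+m}` : `m + 2` unknowns, `m + 1` equations
    obtain ⟨g, hg, j₀, hj₀⟩ : ∃ g : Fin (m + 2) → K,
        ∑ j, g j • (fun i : Fin (m + 1) => a (S + i + j)) = 0 ∧ ∃ j, g j ≠ 0 := by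
      rw [← Fintype.not_linearIndependent_iff]
      intro hli
      have := hli.fintype_card_le_finrank
      rw [Module.finrank_fin_fun, Fintype.card_fin] at this
      omega
    let u : ℕ → K := fun j => if hj : j < m + 2 then g ⟨j, hj⟩ else 0
    have hu : ∀ j : Fin (m + 2), u j = g j := fun j => by simp [u, j.2]
    have huS : ∀ i ≤ m, ∑ j ∈ range (m + 2), u j * a (S + i + j) = 0 := by
      intro i hi
      have := congr_fun hg ⟨i, by omega⟩
      simp only [Finset.sum_apply, Pi.smul_apply, smul_eq_mul, Pi.zero_apply] at this
      rw [Finset.sum_range]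
      simpa only [hu] using this
    -- by induction, `u ⊥ v_t` for all `t ≥ S`
    have hut : ∀ t, S ≤ t → ∑ j ∈ range (m + 2), u j * a (t + j) = 0 := by
      intro t
      induction t using Nat.strong_induction_on with
      | _ t iht =>
        intro ht
        rcases Nat.lt_or_ge t (S + (m + 1)) with h' | h'
        · obtain ⟨i, hi, rfl⟩ : ∃ i ≤ m, t = S + i := ⟨t - S, by omega, by omega⟩
          exact huS i hi
        · obtain ⟨s, hs, rfl⟩ : ∃ s, S ≤ s ∧ t = s + (m + 1) := ⟨t - (m + 1), by omega, by omega⟩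
          calc ∑ j ∈ range (m + 2), u j * a (s + (m + 1) + j)
              = ∑ j ∈ range (m + 2), u j * ∑ i ∈ range (m + 1), d s hs i * a (s + i + j) := by
                refine Finset.sum_congr rfl fun j hj => ?_
                rw [hd s hs j (by simpa [Nat.lt_succ_iff] using hj)]
            _ = ∑ i ∈ range (m + 1), d s hs i * ∑ j ∈ range (m + 2), u j * a (s + i + j) := by
                simp_rw [Finset.mul_sum]
                rw [Finset.sum_comm]
                exact Finset.sum_congr rfl fun i _ => Finset.sum_congr rfl fun j _ => by ring
            _ = 0 := Finset.sum_eq_zero fun i hi => by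
                rw [iht (s + i) (by simp at hi; omega) (by omega), mul_zero]
    -- the polynomial `Q = ∑ u_j X^{m+1-j}`
    set Q : Polynomial K := ∑ j ∈ range (m + 2), Polynomial.C (u j) * Polynomial.X ^ (m + 1 - j)
      with hQdef
    have hQ : Q ≠ 0 := by
      intro hQ
      apply hj₀
      have := congrArg (Polynomial.coeff · (m + 1 - j₀)) hQ
      simp only [hQdef, Polynomial.finsetSum_coeff, Polynomial.coeff_C_mul_X_pow,
        Polynomial.coeff_zero] at this
      rw [Finset.sum_eq_single (j₀ : ℕ), if_pos rfl, hu] at this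
      · exact this
      · intro j hj hne
        rw [if_neg]
        simp at hj
        omega
      · simp [j₀.2]
    -- `mk a * Q` is a polynomial
    obtain ⟨P, hP⟩ := exists_polynomial_of_coeff_eq_zero (PowerSeries.mk a * (Q : PowerSeries K))
      (S + (m + 1)) (by
      intro n hn
      rw [hQdef, ← Polynomial.coeToPowerSeries.ringHom_apply, map_sum, Finset.mul_sum, map_sum]
      simp only [Polynomial.coeToPowerSeries.ringHom_apply, Polynomial.coe_mul, Polynomial.coe_C,
        Polynomial.coe_pow, Polynomial.coe_X, ← mul_assoc, PowerSeries.coeff_mul_X_pow',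
        PowerSeries.coeff_mul_C, PowerSeries.coeff_mk]
      have e : ∀ j ∈ range (m + 2),
          (if m + 1 - j ≤ n then a (n - (m + 1 - j)) * u j else 0) = u j * a (n - (m + 1) + j) := by
        intro j hj
        simp at hj
        rw [if_pos (by omega), mul_comm]
        congr 2; omega
      rw [Finset.sum_congr rfl e]
      exact hut _ (by omega))
    exact ⟨P, Q, hQ, hP⟩

/-- **Kronecker's criterion** (Koblitz, Ch. V §5, Lemma 5, "if" direction): if the Hankel
determinants `N_{s,m} = det (a_{s+i+j})_{0 ≤ i, j ≤ m}` vanish for all `s ≥ S`, then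
`F = ∑ aᵢ Tⁱ ∈ K⟦T⟧` is rational: `F · Q = P` with `P, Q ∈ K[T]`, `Q ≠ 0`. [cite: Koblitz1984, Ch. V §5 Lemma 5] -/
theorem exists_polynomial_of_hankelDet_eq_zero (a : ℕ → K) (m S : ℕ)
    (h : ∀ s, S ≤ s → (hankelMatrix a s m).det = 0) :
    ∃ P Q : Polynomial K, Q ≠ 0 ∧ PowerSeries.mk a * Q = P :=
  exists_polynomial_of_hankelRel a m S fun s hs => (hankelRel_iff_det_eq_zero a s m).mpr (h s hs)

end Dwork
end Literature.NumberTheory.LFunctions
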